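import Summits.QuantumFields.YangMills.Theorems.UnitScaleTiltProp7BCHPieceRows
import HarnessLib

/-!
# Prop 7, route-R E′, (E1-c) brick F4f — THE CHART REMAINDER IN ABSTRACT LATTICE LETTERS AND ITS TRISECTION `N = P₁ + P₂ + P₃` IN EXACTLY THE FORMS OF F4d(ii), F4c(iv-c), F4e

Route `UnitScaleTilt`, crux K1 child «MinimiserStabilityRegPr» (`stmt-QuantumFields-19200`), cell ym3-torus, width seat px15 (gen 2); pen «px15 g2: (E1-c) GO-LOCATE» (★p1 g15,
2026-08-28T20:45:05Z), LOCATE `LOCATE-E1C-DIVLIPSCHITZ-px15g2.md` §3∕§6.  THEOREMS ONLY (0 `def`, 0 `sorry`); `--supports stmt-QuantumFields-19200`, count-neutral.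
YM₃ on T³ is a ladder rung (R3), not the Clay problem; nothing here claims the stub, the crux, d = 4 or the mass gap.

WHAT.  F2 ✓p668882 trisects the chart remainder in `SU(N)` letters `u_m, u_p, W`.  The Lipschitz rows were typed in the ABSTRACT lattice letters of F1 (`T, U, R, covD`): `P₁` in F4d(ii)
✓p674368, `P₂` in F4c(iv-c) ✓p673331, `P₃` in F4e ⧗p674606.  This file bridges: with `u(y) := e^{c•ψ(y)}` (`(c•ψ)* = −c•ψ`, so `u` is unitary), *-compatible transports
(`(R(U)M)* = R(U)(M*)`), data `E(μ,y)` with `‖E − 1‖ < 1` and the pure-gauge product `Q := u(y)·(R(U μ y)u(T μ y))*` with `‖Q − 1‖ < 1`, the chart remainder at the bond `(y, μ)`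
  `N(ψ)(μ,y) := log(u(y)·E·(R(U μ y)u(T μ y))*) − log E + c•D_μψ(y)`  (= F2's `log(u_m E W u_p* W*) − log E − (log u_m − W(log u_p)W*)`)
EQUALS `P₁ + P₂ + P₃` with `P₁ = u(log E)u* − log E` (F4d(ii)'s form), `P₂ = log(1 + e^{−X}(e^{X+H} − e^X)) − H`, `X = (−c)•ψ(y)`, `H = (−c)•D_μψ(y)` (F4c(iv-c)'s form with scalar `−c`),
`P₃ = log(e^{u(log E)u*}·e^{log Q}) − u(log E)u* − log Q` (F4e's form).  Tools: `expField_unitary` (`uu* = u*u = 1`), `star_expField`, `gaugeProduct_eq` (`e^{−X}(e^{X+H} − e^X) = Q − 1`).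
★★★ `chartRemainder_eq_three_pieces`.  HONEST SCOPE.  Algebra ([folklore]); the `(p,q)`-packaging and the torus instantiation remain (successor).

References: T. Bałaban, CMP 98 (1985) 17–51 [Balaban1985Averaging] ((19)–(21) p.21, (32)–(34) p.22); [folklore].
-/

set_option autoImplicit false

noncomputable section

open NormedSpace

namespace Summit.QuantumFields.YangMills.Theorems.Prop7ChartRemainderAbstractTrisection

open Literature.MathematicalPhysics.QuantumFieldTheory.Balaban1983to89
open MatrixLog (mlog mlog_def exp_mlog)
open B9Eq39Adjoint (R covD R_sub)
open Literature.Analysis.Complex (logOnePlus)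
open Literature.Analysis.Calculus.ExpDifferential (exp_neg_mul_exp_eq_one exp_mul_exp_neg_eq_one)
open Summit.QuantumFields.YangMills.Theorems.Prop7ExpFieldRows (R_exp R_smul')
open Summit.QuantumFields.YangMills.Theorems.Prop7BCHPieceRows (exp_conj_unitary)

variable {E : Type*} [NormedRing E] [NormedAlgebra ℂ E] [CompleteSpace E] [StarRing E] [ContinuousStar E]
variable {S : Type*} {ι : Type*} (T : ι → Equiv.Perm S) (U : ι → S → Eˣ)

omit [StarRing E] [ContinuousStar E] in
/-- `e^{X}e^{−X} = 1 = e^{−X}e^{X}`: the exponential field is invertible with inverse `e^{−X}`. [folklore] -/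
theorem expField_mul_exp_neg (X : E) : exp X * exp (-X) = 1 ∧ exp (-X) * exp X = 1 :=
  ⟨exp_mul_exp_neg_eq_one (𝕂 := ℂ) X, exp_neg_mul_exp_eq_one (𝕂 := ℂ) X⟩

omit [CompleteSpace E] in
/-- `(e^{c•ψ})* = e^{−c•ψ}` for skew `c•ψ`. [folklore] -/
theorem star_expField {c : ℂ} {lam : E} (hskew : star (c • lam) = -(c • lam)) : star (exp (c • lam)) = exp (-(c • lam)) := by
  rw [star_exp, hskew]

/-- `e^{c•ψ}` is unitary for skew `c•ψ`: `uu* = 1` and `u*u = 1`. [folklore] -/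
theorem expField_unitary {c : ℂ} {lam : E} (hskew : star (c • lam) = -(c • lam)) :
    exp (c • lam) * star (exp (c • lam)) = 1 ∧ star (exp (c • lam)) * exp (c • lam) = 1 := by
  rw [star_expField hskew]
  exact expField_mul_exp_neg (c • lam)

omit [NormedAlgebra ℂ E] [CompleteSpace E] [StarRing E] [ContinuousStar E] in
/-- `R(u)(−M) = −R(u)M`. [folklore] -/
theorem R_neg' (u : Eˣ) (M : E) : R u (-M) = -R u M := by
  simp only [R, mul_neg, neg_mul]

/-- ★ **THE PURE-GAUGE PRODUCT**: with `X = (−c)•ψ(y)`, `H = (−c)•D_μψ(y)`: `e^{−X}(e^{X+H} − e^X) = u(y)·(R(U μ y)u(T μ y))* − 1`. [cite: Balaban1985Averaging, (32)-(34) p.22] -/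
theorem gaugeProduct_eq (hstarR : ∀ μ y (M : E), star (R (U μ y) M) = R (U μ y) (star M)) {c : ℂ} (ψ : S → E)
    (hskew : ∀ y, star (c • ψ y) = -(c • ψ y)) (μ : ι) (y : S) :
    exp (-((-c) • ψ y)) * (exp ((-c) • ψ y + (-c) • covD T U μ ψ y) - exp ((-c) • ψ y))
      = exp (c • ψ y) * star (R (U μ y) (exp (c • ψ (T μ y)))) - 1 := by
  have h1 : exp (-((-c) • ψ y)) = exp (c • ψ y) := by rw [neg_smul, neg_neg]
  have h2 : exp ((-c) • ψ y) = star (exp (c • ψ y)) := by rw [star_expField (hskew y), neg_smul]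
  have h3 : (-c) • ψ y + (-c) • covD T U μ ψ y = -(R (U μ y) (c • ψ (T μ y))) := by
    simp only [covD, neg_smul, smul_sub, R_smul']; abel
  have h4 : exp ((-c) • ψ y + (-c) • covD T U μ ψ y) = star (R (U μ y) (exp (c • ψ (T μ y)))) := by
    rw [h3, hstarR, star_expField (hskew _), R_exp, R_neg']
  rw [h1, h4, h2, mul_sub, (expField_unitary (hskew y)).1]

/-- ★★★ **THE CHART REMAINDER IS `P₁ + P₂ + P₃`** in the abstract lattice letters (see the module docstring for the three forms). [cite: Balaban1985Averaging, (19)-(21) p.21, (32)-(34) p.22] -/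
theorem chartRemainder_eq_three_pieces (hstarR : ∀ μ y (M : E), star (R (U μ y) M) = R (U μ y) (star M)) {c : ℂ} (ψ : S → E)
    (hskew : ∀ y, star (c • ψ y) = -(c • ψ y)) (En : ι → S → E) (μ : ι) (y : S) (hE : ‖En μ y - 1‖ < 1)
    (hQ : ‖exp (c • ψ y) * star (R (U μ y) (exp (c • ψ (T μ y)))) - 1‖ < 1) :
    mlog (exp (c • ψ y) * En μ y * star (R (U μ y) (exp (c • ψ (T μ y))))) - mlog (En μ y) + c • covD T U μ ψ y
      = (exp (c • ψ y) * mlog (En μ y) * star (exp (c • ψ y)) - mlog (En μ y))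
        + (logOnePlus (exp (-((-c) • ψ y)) * (exp ((-c) • ψ y + (-c) • covD T U μ ψ y) - exp ((-c) • ψ y))) - (-c) • covD T U μ ψ y)
        + (mlog (exp (exp (c • ψ y) * mlog (En μ y) * star (exp (c • ψ y))) * exp (mlog (exp (c • ψ y) * star (R (U μ y) (exp (c • ψ (T μ y)))))))
            - exp (c • ψ y) * mlog (En μ y) * star (exp (c • ψ y))
            - mlog (exp (c • ψ y) * star (R (U μ y) (exp (c • ψ (T μ y)))))) := by
  have hu := expField_unitary (hskew y)
  rw [gaugeProduct_eq T U hstarR ψ hskew μ y, ← mlog_def, exp_conj_unitary hu.2 hu.1, exp_mlog hE, exp_mlog hQ]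
  have hprod : exp (c • ψ y) * En μ y * star (exp (c • ψ y)) * (exp (c • ψ y) * star (R (U μ y) (exp (c • ψ (T μ y)))))
      = exp (c • ψ y) * En μ y * star (R (U μ y) (exp (c • ψ (T μ y)))) := by
    calc _ = exp (c • ψ y) * En μ y * (star (exp (c • ψ y)) * exp (c • ψ y)) * star (R (U μ y) (exp (c • ψ (T μ y)))) := by
          noncomm_ring
      _ = _ := by rw [hu.2, mul_one]
  rw [hprod, neg_smul]
  abel

end Summit.QuantumFields.YangMills.Theorems.Prop7ChartRemainderAbstractTrisection

end
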